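import Literature.Computability.Complexity.MurrayWilliams2018EasyWitnessAssembly
import Literature.Computability.Complexity.MurrayWilliams2018Lemma13QP
import HarnessLib

/-!
# Murray–Williams 2018, Lemma 4.1 in POLYLOGARITHMIC-SEED form: the assembly of §4 from
# Theorem 3.1 and a derandomised advice simulation with `2^{polylog t}` overhead

Literature / circuit complexity. Companion of `MurrayWilliams2018EasyWitnessAssembly.lean`, which
proves the §4 assembly of the named fact `MurrayWilliams2018_lemma_4_1_ae` (C. D. Murray,
R. R. Williams, *Circuit lower bounds for nondeterministic quasi-polytime: an easy witness lemma
for NP and NQP*, STOC 2018 = SIAM J. Comput. 49(5), 2020, Lemma 4.1) from Theorem 3.1 (`h31`,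
universal-referee form) and the derandomised advice simulation `hsim` — a pair language `N'` in
`NTIME (tᵉ)` for one `e` fixed before `s, t`. As that file records ("What is NOT here"), an
`NTIME (tᵉ)` simulation needs a pseudorandom generator with seed `O(log |Y|)` at EVERY hardness
level (Umans 2003, the source's Thm. 2.1), which the tree does not have; what the tree HAS,
proved, is the generator of Impagliazzo–Kabanets–Wigderson's Thm. 11 with seed `c · m⁴` at
table scale `m` (`IKW2002_thm11_tableGenerator`, `IKWGeneratorsProofs.lean`), with which the same
machine `N` runs in time `2^{c m⁴} · t^{O(1)} ≤ 2^{k (log₂ t + 2)ᵏ}`.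

This file therefore proves the SAME assembly for the simulation with that overhead:

* `hsimQ` — the derandomised advice simulation exactly as `hsim` of
  `MurrayWilliams2018_lemma_4_1_ae_of_ingredients` (same referee, move length, advice rate,
  verifier, hardness function, advised game, same conclusion `DecidesOnWithAdvice` at the good
  lengths with the same guard `(ℓ + m ℓ)ᵏ ≤ w n`), except that the pair language `N'` is asked
  to lie in `NTIME T` for every bound `T` with `2^{k (log₂ t(n) + 2)ᵏ} ≤ T(n)` almost everywhere
  (an upper bound on the running time: no constructibility of `T` is involved) instead of in
  `NTIME (tᵉ)`, `e ≥ k`;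
* **`MurrayWilliams2018_lemma_4_1_qp_of_ingredients (h31) (hsimQ)`** — **proved**: Lemma 4.1 in
  polylogarithmic-seed form (the hypothesis `hQ` of `MurrayWilliams2018Lemma13QP.lean`, from
  which Lemma 1.3 at the tree's levels and then Theorem 1.2 for `AC⁰[m]` follow there): the
  printed conclusion of Lemma 4.1 for `s, t` under the printed provisos, assuming `s`-size
  circuits almost everywhere for `NTIME T`, `T` any time-constructible non-decreasing bound with
  `2^{C (log₂ t + 2)^C} ≤ T` a.e. The proof is that of
  `MurrayWilliams2018_lemma_4_1_ae_of_ingredients` VERBATIM (constants `D' = D²+D+2`, `a = 2DD'`,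
  `B = c₀(a+1)`, `c = B+6`, `e = max k 2c + D'`, `g = k`, `d = 1`, and `C = k`; stretch
  `s'(n) = s(c n)`, apply `h31`, bound the move length and the advice, apply the simulation,
  apply the circuit hypothesis to `N'` at the pair lengths of `n` and `s'₂ n`, hard-wire the
  advice, contradict the hardness of `L₁`) — the one changed line being that the circuit
  hypothesis is invoked on `N' ∈ NTIME T`, obtained from `hsimQ` at the given `T`;
* `MurrayWilliams2018_lemma_4_1_qp_of_thm_3_1_universal_of_qsimulation` — the same from
  Theorem 3.1 with general `s₁, s₂` (`h31_of_thm_3_1_universal`);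
* `MurrayWilliams2018_thm_1_2_acc_of_thm_3_1_universal_of_qsimulation_of_expSimulation` —
  Theorem 1.2 for `AC⁰[m]` (the named fact `MurrayWilliams2018_thm_1_2_acc`) from Theorem 3.1
  (universal-referee form, general `s₁, s₂`), the polylogarithmic-seed simulation `hsimQ` and
  the exponential-level simulation `hN` of `MurrayWilliams2018ExpLevel.lean`, through
  `MurrayWilliams2018_thm_1_2_acc_of_lemma_4_1_qp_of_expSimulation`
  (`MurrayWilliams2018Lemma13QP.lean`).

No definition and no named fact is introduced (theorems only; `hsimQ` and `h31` are binders of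
conditional theorems, D-0026). After this file and `MurrayWilliams2018Lemma13QP.lean` the trust
base of `MurrayWilliams2018_thm_1_2_acc` is {Thm. 3.1 in universal-referee form (`h31`), the
polylogarithmic-seed simulation `hsimQ` — a `TM2` machine over the PROVED generator
`IKW2002_thm11_tableGenerator`, on the pattern of `MWSimN` (`MurrayWilliams2018SimulationMachine.lean`)
with the seed ruler `c (⌊log₂ |y|⌋ + 1)⁴` and an exponential pad for the seed enumeration as in
`IKWSim` —, the exponential-level simulation `hN` of `MurrayWilliams2018ExpLevel.lean`}.

## Faithfulness notes

* The source's §4 with Umans' generator replaced by a `c · m⁴`-seed generator: the sentence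
  "`N` nondeterministically guesses an input `z`, and enumerates all `s = |y_hard|ᵍ` seeds to the
  generator `G(y_hard, ·)`" (SIAM p. 315) becomes "all `2^{c (⌊log₂ |y_hard|⌋+1)⁴}` seeds", and
  the running time "`O(t(nᵢ)^{a+g})`" becomes `2^{c (log₂ t + O(1))⁴} · t^{O(1)} ≤ 2^{k (log₂ t + 2)ᵏ}`
  (any `k ≥ 5` absorbs the verifier-dependent constants inside the fourth power). Every other
  step — (4.2), Theorem 3.1, the advice folding, (4.3)/(4.4) — is unchanged, and so is its
  formalization (imported from `MurrayWilliams2018EasyWitnessAssembly.lean`).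
* The polylogarithmic-seed form is weaker than `MurrayWilliams2018_lemma_4_1_ae`
  (`lemma_4_1_qp_of_lemma_4_1_ae`, `MurrayWilliams2018Lemma13QP.lean`) and suffices for
  Lemma 1.3 / Thm. 1.2 / Thm. 1.3 (`MurrayWilliams2018_lemma_1_3_of_lemma_4_1_qp` there), whose
  hypotheses speak of all of `NQP`; it does not give the printed Lemma 1.2 (`NP`).

## References

* C. D. Murray, R. R. Williams, *Circuit lower bounds for nondeterministic quasi-polytime: an
  easy witness lemma for NP and NQP*, STOC 2018, 890–901 = SIAM J. Comput. 49(5) (2020), Thm. 2.1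
  (Umans' generator), Thm. 3.1, Lemma 4.1 and its proof (SIAM pp. 314–316) [MurrayWilliams2018].
* R. Impagliazzo, V. Kabanets, A. Wigderson, *In search of an easy witness: exponential time vs.
  probabilistic polynomial time*, JCSS 65 (2002) 672–694, Thm. 11
  [ImpagliazzoKabanetsWigderson2002].
* S. Arora, B. Barak, *Computational Complexity: A Modern Approach*, CUP 2009, §1.3, Def. 6.16,
  Def. 8.10 [AroraBarakCC2009].
-/

noncomputable section

namespace Literature.Computability.Complexity

open _root_.Computability Filter AMPlayer

/-- **Murray–Williams 2018, Lemma 4.1 in polylogarithmic-seed form, from Theorem 3.1 and the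
derandomised advice simulation with `2^{polylog t}` overhead.** Hypotheses: `h31` — Thm. 3.1 in
universal-referee form at `s₁ = s ∘ s₂`, `s₂ = s^{D'}`, verbatim as in
`MurrayWilliams2018_lemma_4_1_ae_of_ingredients`; `hsimQ` — the advice-taking simulation of an
advised MA game armed with the hard witnesses of a bad input, verbatim as `hsim` there except
that its pair language lies in `NTIME T` for every `T ≥ 2^{k (log₂ t + 2)ᵏ}` a.e. Conclusion:
for the universal constants `e, g, d, C` and all `s, t, T` as displayed, `s`-size circuits a.e.
for `NTIME T` give witness circuits of size `s₂(s₂(s₂ n))^{2g}` for `NTIME t`. Proof: §4 of the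
source, word for word as in `MurrayWilliams2018_lemma_4_1_ae_of_ingredients`, with the circuit
hypothesis applied to `N' ∈ NTIME T`. [cite: MurrayWilliams2018, Lemma 4.1 (proof)] -/
theorem MurrayWilliams2018_lemma_4_1_qp_of_ingredients
    (h31 : ∃ Ref : Language Bool, Ref ∈ Classes.P ∧ ∃ D : ℕ, 1 ≤ D ∧
      ∀ (s : ℕ → ℕ) (D' : ℕ), D * D + D + 2 ≤ D' → StrictMono s → IsTimeConstructible s →
        (∀ᶠ n in atTop, n * s n ^ 2 < 2 ^ n) →
        ∃ (adv : ℕ → List Bool) (L₁ : Language Bool),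
          (∀ n, (adv n).length ≤ D * (Nat.log 2 (s n ^ D') + 1)) ∧
          AdvisedMAGame Ref (mwMoveLen s D D') adv L₁ ∧
          ∀ᶠ n in atTop, s n < L₁.circuitSize n ∨ s (s n ^ D') < L₁.circuitSize (s n ^ D'))
    (hsimQ : ∀ Ref : Language Bool, Ref ∈ Classes.P → ∃ k c₀ : ℕ, 1 ≤ k ∧
      ∀ (t m : ℕ → ℕ) (a : ℕ), IsTimeConstructible t → Monotone t → IsTimeConstructible m →
        (∀ᶠ n in atTop, m n ≤ t n) →
        ∀ {L : Language Bool} (V : NVerifier t L) (w : ℕ → ℕ) (adv : ℕ → List Bool)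
          (L₁ : Language Bool),
          (∀ᶠ n in atTop, (adv n).length ≤ a * n) → AdvisedMAGame Ref m adv L₁ →
          ∃ N' : Language Bool,
            (∀ T : ℕ → ℕ, (∀ᶠ n in atTop, 2 ^ (k * (Nat.log 2 (t n) + 2) ^ k) ≤ T n) →
              N' ∈ NTIME T) ∧
            ∀ᶠ n in atTop, ∀ xh : List Bool, xh ∈ L → xh.length = n →
              (∀ y : List Bool, y.length ≤ V.c * t xh.length + V.c → V.rel xh y = true →
                w xh.length < stringCC y) →
              ∀ ℓ : ℕ, n ≤ ℓ → (ℓ + m ℓ) ^ k ≤ w n → DecidesOnWithAdvice N' (c₀ * (a + 1)) L₁ ℓ) :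
    ∃ e g d C : ℕ, 1 ≤ e ∧ 1 ≤ g ∧ 1 ≤ d ∧ 1 ≤ C ∧
      ∀ (s t T : ℕ → ℕ), StrictMono s → IsTimeConstructible s → IsTimeConstructible t →
        Monotone t → IsTimeConstructible T → Monotone T →
        (∀ᶠ n in atTop, n * s n < 2 ^ (n / e)) →
        (∀ᶠ n in atTop, ((stretch s e)^[3] n) ^ d ≤ t n) →
        (∀ᶠ n in atTop, 2 ^ (C * (Nat.log 2 (t n) + 2) ^ C) ≤ T n) →
        (∀ L ∈ NTIME T, ∀ᶠ n in atTop, L.circuitSize n ≤ s n) →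
          NTIMEHasWitnessCircuits t (fun n => ((stretch s e)^[3] n) ^ (2 * g)) := by
  obtain ⟨Ref, hRef, D, hD, H31⟩ := h31
  obtain ⟨k, c₀, hk, HS⟩ := hsimQ Ref hRef
  -- the constants, all fixed before `s` and `t`
  obtain ⟨D', hD'⟩ : ∃ D' : ℕ, D' = D * D + D + 2 := ⟨_, rfl⟩
  obtain ⟨a, ha⟩ : ∃ a : ℕ, a = 2 * D * D' := ⟨_, rfl⟩
  obtain ⟨B, hB⟩ : ∃ B : ℕ, B = c₀ * (a + 1) := ⟨_, rfl⟩
  obtain ⟨c, hc⟩ : ∃ c : ℕ, c = B + 6 := ⟨_, rfl⟩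
  obtain ⟨e, he⟩ : ∃ e : ℕ, e = max k (2 * c) + D' := ⟨_, rfl⟩
  have h2ce : 2 * c ≤ e := by rw [he]; exact (le_max_right _ _).trans (Nat.le_add_right _ _)
  have hD'e : D' ≤ e := by rw [he]; exact Nat.le_add_left _ _
  have hD'1 : 1 ≤ D' := by rw [hD']; omega
  have hDD'2 : (D + 1) * D ≤ D' := by rw [hD']; nlinarith
  have hc1 : 1 ≤ c := by omega
  have hce : c ≤ e := by omega
  have he1 : 1 ≤ e := by omega
  refine ⟨e, k, 1, k, he1, hk, le_rfl, hk, ?_⟩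
  intro s t T hs hsc htc hmono _hTc _hTm hsa hsb hdom h41
  by_contra hW
  obtain ⟨L, -, V, hbad⟩ := exists_verifier_bad_inputs_of_not_NTIMEHasWitnessCircuits hW
  -- the stretched size functions `s'(n) = s(c n)`, `s'₂ = s'^{D'}`, `S₂ = stretch s e`
  obtain ⟨s', hs'def⟩ : ∃ s' : ℕ → ℕ, s' = fun n => s (c * n) := ⟨_, rfl⟩
  obtain ⟨s₂', hs₂'def⟩ : ∃ s₂' : ℕ → ℕ, s₂' = fun n => s' n ^ D' := ⟨_, rfl⟩
  obtain ⟨S₂, hS₂def⟩ : ∃ S₂ : ℕ → ℕ, S₂ = stretch s e := ⟨_, rfl⟩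
  have hs'ap : ∀ n, s' n = s (c * n) := fun n => by rw [hs'def]
  have hs₂'ap : ∀ n, s₂' n = s' n ^ D' := fun n => by rw [hs₂'def]
  have hS₂ap : ∀ n, S₂ n = s (e * n) ^ e := fun n => by rw [hS₂def, stretch_apply]
  have hS₃ : ∀ n, (stretch s e)^[3] n = S₂ (S₂ (S₂ n)) := fun n => by rw [hS₂def]; rfl
  have hs' : StrictMono s' := fun x y hxy => by
    rw [hs'ap, hs'ap]; exact hs (Nat.mul_lt_mul_of_pos_left hxy hc1)
  have hs'c : IsTimeConstructible s' := by rw [hs'def]; exact hsc.comp_mul_left hc1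
  have hS₂mono : Monotone S₂ := by rw [hS₂def]; exact stretch_monotone hs.monotone e
  have hleS₂ : ∀ n, n ≤ S₂ n := fun n => by rw [hS₂def]; exact id_le_stretch hs he1 n
  have hles' : ∀ n, n ≤ s' n := fun n =>
    (Nat.le_mul_of_pos_left n hc1).trans (by rw [hs'ap]; exact hs.id_le _)
  have hles₂' : ∀ n, n ≤ s₂' n := fun n => by
    rw [hs₂'ap]; exact (hles' n).trans (Nat.le_self_pow (by omega) _)
  have hs₂'S₂ : ∀ x, s₂' x ≤ S₂ x := fun x => by
    rw [hs₂'ap, hS₂ap, hs'ap]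
    calc s (c * x) ^ D' ≤ s (e * x) ^ D' :=
          Nat.pow_le_pow_left (hs.monotone (Nat.mul_le_mul_right x hce)) D'
      _ ≤ s (e * x) ^ e := pow_le_pow_right_of_one_le hD'1 hD'e
  -- the move length `m = (s'(s'₂ n) · s'₂ n)^D ≤ s'₂ (s'₂ n) ≤ S₂ (S₂ n)`
  obtain ⟨m, hmdef⟩ : ∃ m : ℕ → ℕ, m = mwMoveLen s' D D' := ⟨_, rfl⟩
  have hmc : IsTimeConstructible m := by
    rw [hmdef]; exact isTimeConstructible_mwMoveLen hs'c hD hD'1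
  have hm_le : ∀ ℓ, m ℓ ≤ s₂' (s₂' ℓ) := fun ℓ => by
    rw [hmdef, mwMoveLen_apply, hs₂'ap, hs₂'ap]
    calc (s' (s' ℓ ^ D') ^ D * s' ℓ ^ D') ^ D ≤ (s' (s' ℓ ^ D') ^ D * s' (s' ℓ ^ D')) ^ D :=
          Nat.pow_le_pow_left (Nat.mul_le_mul_left _ (hles' _)) D
      _ = s' (s' ℓ ^ D') ^ ((D + 1) * D) := by rw [← pow_succ, ← pow_mul]
      _ ≤ s' (s' ℓ ^ D') ^ D' := pow_le_pow_right_of_one_le (by nlinarith) hDD'2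
  have hs₂'s₂' : ∀ ℓ, s₂' (s₂' ℓ) ≤ S₂ (S₂ ℓ) := fun ℓ =>
    (hs₂'S₂ _).trans (hS₂mono (hs₂'S₂ ℓ))
  have hmS : ∀ ℓ, m ℓ ≤ S₂ (S₂ (S₂ ℓ)) := fun ℓ =>
    ((hm_le ℓ).trans (hs₂'s₂' ℓ)).trans (hleS₂ _)
  have hmt : ∀ᶠ n in atTop, m n ≤ t n := by
    filter_upwards [hsb] with n hn
    rw [pow_one, hS₃] at hn
    exact (hmS n).trans hn
  -- smallness of `s'`: `c n · s'(n) < 2^{n/2}`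
  have hsmall : ∀ᶠ n in atTop, n * s' n ^ 2 < 2 ^ n := by
    obtain ⟨N₀, hN₀⟩ := eventually_atTop.1 hsa
    refine eventually_atTop.2 ⟨N₀, fun n hn => ?_⟩
    have hcn : N₀ ≤ c * n := hn.trans (Nat.le_mul_of_pos_left n hc1)
    have h1 : c * n * s (c * n) < 2 ^ (c * n / e) := hN₀ _ hcn
    have h2 : c * n / e ≤ n / 2 :=
      calc c * n / e ≤ c * n / (2 * c) := Nat.div_le_div_left h2ce (by omega)
        _ = n / 2 := by rw [mul_comm 2 c, Nat.mul_div_mul_left n 2 (by omega)]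
    have h3 : c * n * s' n < 2 ^ (n / 2) := by
      rw [hs'ap]; exact lt_of_lt_of_le h1 (Nat.pow_le_pow_right (by norm_num) h2)
    have h4 : (c * n * s' n) ^ 2 < (2 ^ (n / 2)) ^ 2 := Nat.pow_lt_pow_left h3 (by norm_num)
    have h5 : (2 ^ (n / 2)) ^ 2 ≤ 2 ^ n := by
      rw [← pow_mul]; exact Nat.pow_le_pow_right (by norm_num) (by omega)
    have h6 : n * s' n ^ 2 ≤ (c * n * s' n) ^ 2 := by
      rw [mul_pow]
      refine Nat.mul_le_mul_right _ ?_
      calc n ≤ c * n := Nat.le_mul_of_pos_left n hc1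
        _ ≤ (c * n) ^ 2 := Nat.le_self_pow two_ne_zero _
    omega
  -- Theorem 3.1 at `s'`
  obtain ⟨adv, L₁, hadv, hgame, hhard⟩ := H31 s' D' (by rw [hD']) hs' hs'c hsmall
  -- the advice is linear
  have hs'lt : ∀ᶠ n in atTop, s' n < 2 ^ n := by
    filter_upwards [hsmall, eventually_ge_atTop 1] with n h hn
    have : s' n ≤ n * s' n ^ 2 :=
      (Nat.le_self_pow two_ne_zero _).trans (Nat.le_mul_of_pos_left _ hn)
    omega
  have hadv' : ∀ᶠ n in atTop, (adv n).length ≤ a * n := by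
    filter_upwards [hs'lt, eventually_ge_atTop 1] with n hlt hn
    have hlog : Nat.log 2 (s' n ^ D') ≤ D' * n := by
      rcases Nat.eq_zero_or_pos (s' n ^ D') with h0 | hpos
      · rw [h0, Nat.log_zero_right]; exact Nat.zero_le _
      · have hlt' : s' n ^ D' < 2 ^ (D' * n) :=
          calc s' n ^ D' < (2 ^ n) ^ D' := Nat.pow_lt_pow_left hlt (by omega)
            _ = 2 ^ (D' * n) := by rw [← pow_mul, mul_comm]
        exact ((Nat.log_lt_iff_lt_pow one_lt_two hpos.ne').2 hlt').le
    calc (adv n).length ≤ D * (Nat.log 2 (s' n ^ D') + 1) := hadv n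
      _ ≤ D * (D' * n + 1) := Nat.mul_le_mul_left D (by omega)
      _ ≤ a * n := by rw [ha]; nlinarith
  -- the derandomised simulation, with `2^{polylog t}` overhead
  obtain ⟨N', hN', hdec⟩ := HS t m a htc hmono hmc hmt V
    (fun n => ((stretch s e)^[3] n) ^ (2 * k)) adv L₁ hadv' (by rw [hmdef]; exact hgame)
  -- the circuit hypothesis for `N' ∈ NTIME T`, at the pair lengths of `n` and of `s'₂ n`
  have h41N : ∀ᶠ M in atTop, N'.circuitSize M ≤ s M := h41 N' (hN' T hdom)
  have hMtend : Tendsto (fun ℓ : ℕ => 2 * ℓ + B * ℓ + 2) atTop atTop :=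
    tendsto_atTop_mono (fun ℓ => show ℓ ≤ 2 * ℓ + B * ℓ + 2 by omega) tendsto_id
  have hs₂tend : Tendsto s₂' atTop atTop := tendsto_atTop_mono hles₂' tendsto_id
  have h41a : ∀ᶠ n in atTop, N'.circuitSize (2 * n + B * n + 2) ≤ s (2 * n + B * n + 2) :=
    hMtend.eventually h41N
  have h41b : ∀ᶠ n in atTop,
      N'.circuitSize (2 * s₂' n + B * s₂' n + 2) ≤ s (2 * s₂' n + B * s₂' n + 2) :=
    hs₂tend.eventually h41a
  -- the guards of the simulation at `ℓ = n` and `ℓ = s'₂ n`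
  have hG : ∀ᶠ n in atTop, (n + m n) ^ k ≤ ((stretch s e)^[3] n) ^ (2 * k) ∧
      (s₂' n + m (s₂' n)) ^ k ≤ ((stretch s e)^[3] n) ^ (2 * k) := by
    filter_upwards [eventually_ge_atTop 2] with n hn
    rw [hS₃]
    have hS3 : 2 ≤ S₂ (S₂ (S₂ n)) := hn.trans ((hleS₂ n).trans ((hleS₂ _).trans (hleS₂ _)))
    have key : ∀ x, x ≤ S₂ (S₂ (S₂ n)) + S₂ (S₂ (S₂ n)) → x ^ k ≤ S₂ (S₂ (S₂ n)) ^ (2 * k) := by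
      intro x hx
      rw [pow_mul]
      refine Nat.pow_le_pow_left (hx.trans ?_) k
      rw [pow_two]
      nlinarith
    constructor
    · exact key _ (Nat.add_le_add ((hleS₂ n).trans ((hleS₂ _).trans (hleS₂ _))) (hmS n))
    · refine key _ (Nat.add_le_add ?_ ?_)
      · exact (hs₂'S₂ n).trans ((hleS₂ _).trans (hleS₂ _))
      · calc m (s₂' n) ≤ s₂' (s₂' (s₂' n)) := hm_le _
          _ ≤ S₂ (s₂' (s₂' n)) := hs₂'S₂ _
          _ ≤ S₂ (S₂ (S₂ n)) := hS₂mono (hs₂'s₂' n)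
  -- a large bad length with all of the above
  obtain ⟨n, ⟨x, hxL, hxn, hxbad⟩, hhard_n, hdec_n, h41a_n, h41b_n, ⟨hG1, hG2⟩, hn2⟩ :=
    (hbad.and_eventually (hhard.and (hdec.and (h41a.and (h41b.and (hG.and
      (eventually_ge_atTop 2))))))).exists
  -- small circuits for `L₁` at `n` and at `s'₂ n`
  have hfold : ∀ ℓ, 1 ≤ ℓ → s (2 * ℓ + B * ℓ + 2) + 2 ≤ s' ℓ := fun ℓ hℓ =>
    calc s (2 * ℓ + B * ℓ + 2) + 2 ≤ s (2 * ℓ + B * ℓ + 2 + 2) :=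
          add_le_apply_add_of_strictMono hs _ 2
      _ ≤ s (c * ℓ) := hs.monotone (by rw [hc]; nlinarith)
      _ = s' ℓ := (hs'ap ℓ).symm
  have d₁ : DecidesOnWithAdvice N' (c₀ * (a + 1)) L₁ n := hdec_n x hxL hxn hxbad n le_rfl hG1
  have d₂ : DecidesOnWithAdvice N' (c₀ * (a + 1)) L₁ (s₂' n) :=
    hdec_n x hxL hxn hxbad (s₂' n) (hles₂' n) hG2
  have c₁ : L₁.circuitSize n ≤ s' n :=
    calc L₁.circuitSize n ≤ N'.circuitSize (2 * n + c₀ * (a + 1) * n + 2) + 2 := d₁.circuitSize_le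
      _ ≤ s (2 * n + B * n + 2) + 2 := by rw [← hB]; exact Nat.add_le_add_right h41a_n 2
      _ ≤ s' n := hfold n (by omega)
  have c₂ : L₁.circuitSize (s₂' n) ≤ s' (s₂' n) :=
    calc L₁.circuitSize (s₂' n) ≤ N'.circuitSize (2 * s₂' n + c₀ * (a + 1) * s₂' n + 2) + 2 :=
          d₂.circuitSize_le
      _ ≤ s (2 * s₂' n + B * s₂' n + 2) + 2 := by rw [← hB]; exact Nat.add_le_add_right h41b_n 2
      _ ≤ s' (s₂' n) := hfold (s₂' n) ((show 1 ≤ n by omega).trans (hles₂' n))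
  -- contradiction with the hardness of `L₁`
  rw [← hs₂'ap] at hhard_n
  rcases hhard_n with h | h
  · exact absurd c₁ (not_le.2 h)
  · exact absurd c₂ (not_le.2 h)

/-- **Lemma 4.1 in polylogarithmic-seed form from Theorem 3.1 in universal-referee form
(general `s₁, s₂`) and the polylogarithmic-seed simulation** (`h31_of_thm_3_1_universal` of
`MurrayWilliams2018EasyWitnessAssembly.lean`). [cite: MurrayWilliams2018, Lemma 4.1] -/
theorem MurrayWilliams2018_lemma_4_1_qp_of_thm_3_1_universal_of_qsimulation
    (h31 : ∃ Ref : Language Bool, Ref ∈ Classes.P ∧ ∃ D : ℕ, 1 ≤ D ∧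
      ∀ (s s₁ s₂ : ℕ → ℕ), StrictMono s → IsTimeConstructible s →
        (∀ᶠ n in atTop, n * s n ^ 2 < 2 ^ n) →
        IsTimeConstructible s₁ → IsTimeConstructible s₂ →
        (∀ᶠ n in atTop, (n + s n + 2) ^ D ≤ s₂ n) → (∀ᶠ n in atTop, s (s₂ n) ^ D ≤ s₁ n) →
        (∀ᶠ n in atTop, (n + s n + 2) ^ D ≤ s₁ n) →
        ∃ (adv : ℕ → List Bool) (L₁ : Language Bool),
          (∀ n, (adv n).length ≤ D * (Nat.log 2 (s₂ n) + 1)) ∧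
          AdvisedMAGame Ref (fun n => (s₁ n * s₂ n) ^ D) adv L₁ ∧
          ∀ᶠ n in atTop, s n < L₁.circuitSize n ∨ s (s₂ n) < L₁.circuitSize (s₂ n))
    (hsimQ : ∀ Ref : Language Bool, Ref ∈ Classes.P → ∃ k c₀ : ℕ, 1 ≤ k ∧
      ∀ (t m : ℕ → ℕ) (a : ℕ), IsTimeConstructible t → Monotone t → IsTimeConstructible m →
        (∀ᶠ n in atTop, m n ≤ t n) →
        ∀ {L : Language Bool} (V : NVerifier t L) (w : ℕ → ℕ) (adv : ℕ → List Bool)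
          (L₁ : Language Bool),
          (∀ᶠ n in atTop, (adv n).length ≤ a * n) → AdvisedMAGame Ref m adv L₁ →
          ∃ N' : Language Bool,
            (∀ T : ℕ → ℕ, (∀ᶠ n in atTop, 2 ^ (k * (Nat.log 2 (t n) + 2) ^ k) ≤ T n) →
              N' ∈ NTIME T) ∧
            ∀ᶠ n in atTop, ∀ xh : List Bool, xh ∈ L → xh.length = n →
              (∀ y : List Bool, y.length ≤ V.c * t xh.length + V.c → V.rel xh y = true →
                w xh.length < stringCC y) →
              ∀ ℓ : ℕ, n ≤ ℓ → (ℓ + m ℓ) ^ k ≤ w n → DecidesOnWithAdvice N' (c₀ * (a + 1)) L₁ ℓ) :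
    ∃ e g d C : ℕ, 1 ≤ e ∧ 1 ≤ g ∧ 1 ≤ d ∧ 1 ≤ C ∧
      ∀ (s t T : ℕ → ℕ), StrictMono s → IsTimeConstructible s → IsTimeConstructible t →
        Monotone t → IsTimeConstructible T → Monotone T →
        (∀ᶠ n in atTop, n * s n < 2 ^ (n / e)) →
        (∀ᶠ n in atTop, ((stretch s e)^[3] n) ^ d ≤ t n) →
        (∀ᶠ n in atTop, 2 ^ (C * (Nat.log 2 (t n) + 2) ^ C) ≤ T n) →
        (∀ L ∈ NTIME T, ∀ᶠ n in atTop, L.circuitSize n ≤ s n) →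
          NTIMEHasWitnessCircuits t (fun n => ((stretch s e)^[3] n) ^ (2 * g)) :=
  MurrayWilliams2018_lemma_4_1_qp_of_ingredients (h31_of_thm_3_1_universal h31) hsimQ

/-- **Murray–Williams' Theorem 1.2 for `AC⁰[m]` (`MurrayWilliams2018_thm_1_2_acc`) from its three
remaining components**: Theorem 3.1 in universal-referee form with general `s₁, s₂` (`h31`), the
polylogarithmic-seed advice simulation (`hsimQ`, a machine over the proved generator
`IKW2002_thm11_tableGenerator`) and the exponential-level simulation (`hN`, verbatim from
`MurrayWilliams2018ExpLevel.lean`) — Lemma 4.1 in polylogarithmic-seed form by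
`MurrayWilliams2018_lemma_4_1_qp_of_thm_3_1_universal_of_qsimulation`, then Lemma 1.3 and the §5
assembly by `MurrayWilliams2018_thm_1_2_acc_of_lemma_4_1_qp_of_expSimulation`; the hierarchy
theorem, the `ACC`-SAT side and the generator are theorems of the tree.
[cite: MurrayWilliams2018, Thm. 1.2 (proof, §§3–5)] -/
theorem MurrayWilliams2018_thm_1_2_acc_of_thm_3_1_universal_of_qsimulation_of_expSimulation
    (h31 : ∃ Ref : Language Bool, Ref ∈ Classes.P ∧ ∃ D : ℕ, 1 ≤ D ∧
      ∀ (s s₁ s₂ : ℕ → ℕ), StrictMono s → IsTimeConstructible s →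
        (∀ᶠ n in atTop, n * s n ^ 2 < 2 ^ n) →
        IsTimeConstructible s₁ → IsTimeConstructible s₂ →
        (∀ᶠ n in atTop, (n + s n + 2) ^ D ≤ s₂ n) → (∀ᶠ n in atTop, s (s₂ n) ^ D ≤ s₁ n) →
        (∀ᶠ n in atTop, (n + s n + 2) ^ D ≤ s₁ n) →
        ∃ (adv : ℕ → List Bool) (L₁ : Language Bool),
          (∀ n, (adv n).length ≤ D * (Nat.log 2 (s₂ n) + 1)) ∧
          AdvisedMAGame Ref (fun n => (s₁ n * s₂ n) ^ D) adv L₁ ∧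
          ∀ᶠ n in atTop, s n < L₁.circuitSize n ∨ s (s₂ n) < L₁.circuitSize (s₂ n))
    (hsimQ : ∀ Ref : Language Bool, Ref ∈ Classes.P → ∃ k c₀ : ℕ, 1 ≤ k ∧
      ∀ (t m : ℕ → ℕ) (a : ℕ), IsTimeConstructible t → Monotone t → IsTimeConstructible m →
        (∀ᶠ n in atTop, m n ≤ t n) →
        ∀ {L : Language Bool} (V : NVerifier t L) (w : ℕ → ℕ) (adv : ℕ → List Bool)
          (L₁ : Language Bool),
          (∀ᶠ n in atTop, (adv n).length ≤ a * n) → AdvisedMAGame Ref m adv L₁ →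
          ∃ N' : Language Bool,
            (∀ T : ℕ → ℕ, (∀ᶠ n in atTop, 2 ^ (k * (Nat.log 2 (t n) + 2) ^ k) ≤ T n) →
              N' ∈ NTIME T) ∧
            ∀ᶠ n in atTop, ∀ xh : List Bool, xh ∈ L → xh.length = n →
              (∀ y : List Bool, y.length ≤ V.c * t xh.length + V.c → V.rel xh y = true →
                w xh.length < stringCC y) →
              ∀ ℓ : ℕ, n ≤ ℓ → (ℓ + m ℓ) ^ k ≤ w n → DecidesOnWithAdvice N' (c₀ * (a + 1)) L₁ ℓ)
    (hN : ∃ c₀ : ℕ, ∀ (d m k r : ℕ), 2 ≤ m → 1 ≤ k → 2 ≤ r →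
      AccSatSubexp (d + c₀) m r →
      (Classes.P ⊆ ⋃ a : ℕ,
          DepthSizeClass (accBasis m) (fun _ => d) (fun n => a * 2 ^ Nat.log 2 n ^ k + a)) →
      ∃ q : ℕ, 1 ≤ q ∧ ∀ L ∈ NTIME (fun n => 2 ^ n),
        HasWitnessCircuits (fun n => 2 ^ (n ^ 3)) L (fun n => 2 ^ Nat.nthRoot q n) →
        L ∈ NTIME williamsBound) :
    MurrayWilliams2018_thm_1_2_acc :=
  MurrayWilliams2018_thm_1_2_acc_of_lemma_4_1_qp_of_expSimulation
    (MurrayWilliams2018_lemma_4_1_qp_of_thm_3_1_universal_of_qsimulation h31 hsimQ) hN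

end Literature.Computability.Complexity

end
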